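import Summits.AtomisticToContinuum.FouriersLaw.Theses.LatticeLandauDamping
import Summits.AtomisticToContinuum.FouriersLaw.Theses.FourierGreenKubo
import Summits.AtomisticToContinuum.FouriersLaw.Theses.SelfDephasing
import Summits.AtomisticToContinuum.FouriersLaw.Theses.HermiteLadder
import Summits.AtomisticToContinuum.FouriersLaw.Theses.TangentFlowDephasing
import Literature.MathematicalPhysics.KineticTheory.InfiniteChainGibbsExistence
import Literature.MathematicalPhysics.KineticTheory.InfiniteChainGibbsInvariance

/-!
# `InfiniteVolumeSetup` (item stmt-AtomisticToContinuum-0743) — PROVED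

The shared support item of the Fourier's-law routes `LatticeLandauDamping`, `FourierGreenKubo`,
`SelfDephasing`, `HermiteLadder`, `TangentFlowDephasing` (one statement, five route decls):
for the pinned anharmonic chain `pinnedChain ω₂ lam β γ` (all parameters `> 0`) and every `T > 0`
there is a DLR Gibbs state `μ_T` (`IsChainGibbsMeasure T μ_T`) and an infinite-volume dynamics
`D : InfiniteChainDynamics` preserving it (`D.PreservesMeasure μ_T`).

Proof = two tree theorems:
* STATE: `OscillatorChain.exists_isChainGibbsMeasure_hasSuperstabilityEstimate_pinnedChain`
  (`Literature/…/InfiniteChainGibbsExistence.lean`): the two-sided stationary Markov chain of the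
  transfer operator `e^{-V(q'-q)/T}` on `L²(e^{-(p²/2+U)/T} dq dp)` (Jentzsch eigenfunction,
  Kolmogorov extension, DLR for every finite `Λ`), which obeys Buttà–Marchioro's superstability
  estimate (2.3);
* DYNAMICS: `OscillatorChain.exists_bmDynamics` (`Literature/…/InfiniteChainGibbsInvariance.lean`):
  the Buttà–Marchioro flow on the superstable set `𝒳₀` (carrier `bmGood`, measurable flow maps),
  which preserves every Gibbs state obeying (2.3).

* `infiniteVolumeSetup_strong` — the witness with its extra structure (superstable state; dynamics
  with carrier `bmGood`, measurable flow, group law) for downstream items;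
* `infiniteVolumeSetup_proof` — the route decl of `LatticeLandauDamping`; and the four sibling
  decls `fourierGreenKubo_infiniteVolumeSetup`, `selfDephasing_infiniteVolumeSetup`,
  `hermiteLadder_infiniteVolumeSetup`, `tangentFlowDephasing_infiniteVolumeSetup`.
-/

noncomputable section

namespace Summit.AtomisticToContinuum.FouriersLaw.Theorems.InfiniteVolumeSetup

open MeasureTheory Literature.MathematicalPhysics.KineticTheory.HeatConduction

/-- **Infinite-volume set-up, strong form.** For `pinnedChain ω₂ lam β γ` (`ω₂, lam, β > 0`, any
`γ`) and `T > 0`: a DLR Gibbs state `μ` obeying Buttà–Marchioro's superstability estimate (2.3), and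
an infinite-volume dynamics `D` with carrier the superstable set `bmGood`, measurable flow maps and
the group law on the carrier, preserving `μ`. [cite: ButtaMarchioro2016, §2 Thm 2.1 and eq. (2.6)] -/
theorem infiniteVolumeSetup_strong {ω₂ lam β : ℝ} (γ : ℝ) (hω : 0 < ω₂) (hl : 0 < lam) (hβ : 0 < β)
    {T : ℝ} (hT : 0 < T) :
    ∃ (μ : Measure ChainConfig) (D : InfiniteChainDynamics (pinnedChain ω₂ lam β γ)),
      (pinnedChain ω₂ lam β γ).IsChainGibbsMeasure T μ ∧
      (pinnedChain ω₂ lam β γ).HasSuperstabilityEstimate μ ∧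
      D.carrier = (pinnedChain ω₂ lam β γ).bmGood ∧ (∀ t : ℝ, Measurable (D.flow t)) ∧
      (∀ t s : ℝ, ∀ σ ∈ (pinnedChain ω₂ lam β γ).bmGood, D.flow (t + s) σ = D.flow t (D.flow s σ)) ∧
      D.PreservesMeasure μ := by
  obtain ⟨μ, hG, hSS⟩ :=
    OscillatorChain.exists_isChainGibbsMeasure_hasSuperstabilityEstimate_pinnedChain γ hω hl.le hβ.le hT
  obtain ⟨D, hcar, hmeas, -, hgrp, -, -, hpres⟩ :=
    OscillatorChain.exists_bmDynamics (P := pinnedChain ω₂ lam β γ) (s₁ := 2) (s₂ := 2)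
      (by norm_num) (by norm_num) (OscillatorChain.pinnedChain_isEvenPolyOfDegree_U β γ hω.le hl)
      (OscillatorChain.pinnedChain_isEvenPolyOfDegree_V ω₂ lam γ hβ)
  exact ⟨μ, D, hG, hSS, hcar, hmeas, hgrp, hpres T μ hG hSS⟩

/-- **The shared statement**, in Literature vocabulary: for all parameters `> 0` and `T > 0` a Gibbs
state and a dynamics preserving it. [cite: ButtaMarchioro2016, §2 Thm 2.1 and eq. (2.6)] -/
theorem infiniteVolumeSetup :
    ∀ ω₂ lam β γ : ℝ, 0 < ω₂ → 0 < lam → 0 < β → 0 < γ → ∀ T : ℝ, 0 < T →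
      ∃ μ : Measure ChainConfig, (pinnedChain ω₂ lam β γ).IsChainGibbsMeasure T μ ∧
        ∃ D : InfiniteChainDynamics (pinnedChain ω₂ lam β γ), D.PreservesMeasure μ := by
  intro ω₂ lam β γ hω hl hβ _ T hT
  obtain ⟨μ, D, hG, -, -, -, -, hpres⟩ := infiniteVolumeSetup_strong γ hω hl hβ hT
  exact ⟨μ, hG, D, hpres⟩

/-- **Item stmt-AtomisticToContinuum-0743, route `LatticeLandauDamping`.**
[cite: ButtaMarchioro2016, §2 Thm 2.1 and eq. (2.6)] -/
theorem infiniteVolumeSetup_proof :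
    Summit.AtomisticToContinuum.FouriersLaw.Theses.LatticeLandauDamping.InfiniteVolumeSetup := by
  unfold Summit.AtomisticToContinuum.FouriersLaw.Theses.LatticeLandauDamping.InfiniteVolumeSetup
  exact infiniteVolumeSetup

/-- The same statement as the route decl of `FourierGreenKubo`.
[cite: ButtaMarchioro2016, §2 Thm 2.1 and eq. (2.6)] -/
theorem fourierGreenKubo_infiniteVolumeSetup :
    Summit.AtomisticToContinuum.FouriersLaw.Theses.FourierGreenKubo.InfiniteVolumeSetup := by
  unfold Summit.AtomisticToContinuum.FouriersLaw.Theses.FourierGreenKubo.InfiniteVolumeSetup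
  exact infiniteVolumeSetup

/-- The same statement as the route decl of `SelfDephasing`.
[cite: ButtaMarchioro2016, §2 Thm 2.1 and eq. (2.6)] -/
theorem selfDephasing_infiniteVolumeSetup :
    Summit.AtomisticToContinuum.FouriersLaw.Theses.SelfDephasing.InfiniteVolumeSetup := by
  unfold Summit.AtomisticToContinuum.FouriersLaw.Theses.SelfDephasing.InfiniteVolumeSetup
  exact infiniteVolumeSetup

/-- The same statement as the route decl of `HermiteLadder`.
[cite: ButtaMarchioro2016, §2 Thm 2.1 and eq. (2.6)] -/
theorem hermiteLadder_infiniteVolumeSetup :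
    Summit.AtomisticToContinuum.FouriersLaw.Theses.HermiteLadder.InfiniteVolumeSetup := by
  unfold Summit.AtomisticToContinuum.FouriersLaw.Theses.HermiteLadder.InfiniteVolumeSetup
  exact infiniteVolumeSetup

/-- The same statement as the route decl of `TangentFlowDephasing`.
[cite: ButtaMarchioro2016, §2 Thm 2.1 and eq. (2.6)] -/
theorem tangentFlowDephasing_infiniteVolumeSetup :
    Summit.AtomisticToContinuum.FouriersLaw.Theses.TangentFlowDephasing.InfiniteVolumeSetup := by
  unfold Summit.AtomisticToContinuum.FouriersLaw.Theses.TangentFlowDephasing.InfiniteVolumeSetup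
  exact infiniteVolumeSetup

end Summit.AtomisticToContinuum.FouriersLaw.Theorems.InfiniteVolumeSetup

end
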